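import Mathlib.Analysis.CStarAlgebra.Classes
import Mathlib.Algebra.Star.StarAlgHom
import Mathlib.Analysis.Complex.Basic
import Mathlib.Analysis.Calculus.Deriv.Basic
import Mathlib.Analysis.Convex.Basic
import Mathlib.Analysis.Complex.HasPrimitives
import Mathlib.Analysis.Complex.Liouville
import Mathlib.Algebra.Order.ToIntervalMod
import Literature.MathematicalPhysics.QuantumLattice.QuasiLocalAlgebra
import HarnessLib

-- provenance: harness21/H21/H21/Prelude/AnalysisL/KMSStates.lean @ b1c2cc2 (interim HEAD d8f2665); M5 mechanical rewrite
/-!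
# KMS states and analytic ground states of a C⋆-dynamical system (trunk AnalysisL, item P4)

Notions `quasi_local_algebra` and `cstar_state_gns`. For a strongly continuous one-parameter
group of ⋆-automorphisms `τ` of a unital C⋆-algebra `A` (the accepted `IsAutomorphismGroup τ`,
item Q15 `QuasiLocalAlgebra`) and an inverse temperature `β > 0`, a state `ω` is a
**`(τ, β)`-KMS state** (Kubo–Martin–Schwinger; Haag–Hugenholtz–Winnink 1967) if for all
`a b ∈ A` there is a bounded continuous function `F_{a,b}` on the closed strip
`0 ≤ Im z ≤ β`, analytic in the open strip, with boundary values
`F(t) = ω(a τ_t(b))` and `F(t + iβ) = ω(τ_t(b) a)` (Bratteli–Robinson II Def. 5.3.1 in the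
strip form of Prop. 5.3.7). The `β = +∞` version (bounded analytic function on the upper
half-plane with `F(t) = ω(a τ_t(b))`) is the analytic characterisation of **ground states**
(Bratteli–Robinson II Def. 5.3.18, Prop. 5.3.19), equivalent — for states of the C⋆-algebra,
i.e. positive normalised functionals — to the generator form `-i ω(a⋆ δ(a)) ≥ 0`, which is the
accepted `State.IsGroundState` (item Q15); the bridge is the theorem
`State.isGroundState_iff_isKMSGroundState'` / the named fact
`State.isGroundState_iff_isKMSGroundState_of_starOrderedRing` of
`Literature/Analysis/FunctionSpaces/KMSStatesGroundStateProofs.lean` (the record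
`State.isGroundState_iff_isKMSGroundState` of this file is mis-stated and DEPRECATED, see below).

Contents (root `namespace Literature`, predicates dot-namespaced on `Literature.MathematicalPhysics.QuantumLattice.State` like the accepted
`State.IsGroundState`):
* `IsEntireElementFor τ a F` (entire analytic elements, BR I Def. 2.5.20), `kmsStrip β`;
* `State.IsKMSState ω τ β`, `State.IsKMSGroundState ω τ`, `kmsStates τ β`, `kmsGroundStates τ`;
* `State.IsKMSState.apply_dynamics` (KMS states are `τ`-invariant, BR II Prop. 5.3.3),
  `State.isGroundState_iff_isKMSGroundState` (BR II Prop. 5.3.19; **DEPRECATED 2026-08-15,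
  mis-stated**: declared over an arbitrary `[PartialOrder A]`, for which `State A` need not
  consist of positive functionals, whereas the source concerns states of the C⋆-algebra; refuted
  as stated by `KMSGroundStateCounterexample.not_isGroundState_iff_isKMSGroundState`
  (`KMSStatesCounterexample.lean`); statement kept verbatim under `@[deprecated]` because that
  refutation names it; the corrected statement, with `[StarOrderedRing A]`, is the named fact
  `State.isGroundState_iff_isKMSGroundState_of_starOrderedRing` of
  `KMSStatesGroundStateProofs.lean`, discharged there by
  `State.isGroundState_iff_isKMSGroundState_of_starOrderedRing_holds` through the theorem
  `State.isGroundState_iff_isKMSGroundState'`),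
  `State.isKMSState_iff_entire` (BR II Def. 5.3.1 ⇔ Prop. 5.3.7; MIS-STATED as a bare closure —
  false for a general `[PartialOrder A]`, see its docstring; statement kept unchanged, and
  discharged at every C⋆-ordered `A`, i.e. under `[StarOrderedRing A]`, as
  `State.isKMSState_iff_entire_holds` in `KMSStatesProofs.lean`),
  `convex_kmsStates`, `isClosed_kmsStates` (BR II Thm. 5.3.30 (1)), `kmsGroundStates_eq`;
  `State.isKMSState_iff_entire'` (corrected statement of `State.isKMSState_iff_entire`, with
  `[StarOrderedRing A]` so that states are continuous; proved as
  `State.isKMSState_iff_entire'_holds` in `KMSStatesProofs.lean`).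
* Appendix (`namespace Literature.QLattice`): `InSameGappedPhase Φ₀ Φ₁ R`, two finite-range lattice
  interactions connected by a continuous path of uniformly gapped interactions with unique
  ground state (Chen–Gu–Wen 2010 §II; Bachmann–Michalakis–Nachtergaele–Sims 2012 §1), with
  `InSameGappedPhase.refl` and `InSameGappedPhase.symm`.
* Discharge (`section KMSInvariance`, sorry-free): `State.IsKMSState.apply_dynamics_holds` proves
  the named fact `State.IsKMSState.apply_dynamics` (BR II Prop. 5.3.3) directly from the strip
  form, via `differentiableOn_of_continuousOn_of_differentiableOn_off_im_eq` (Morera across a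
  horizontal line, from Mathlib's `Complex.isConservativeOn_and_continuousOn_iff_isDifferentiableOn`),
  `differentiableOn_kmsGlue` and `apply_ofReal_eq_of_kmsPeriodic` (the `iβ`-periodic extension of
  `F_{1,a}` is bounded entire, hence constant by Liouville).

## Sources

* R. Haag, N. M. Hugenholtz, M. Winnink, *On the equilibrium states in quantum statistical
  mechanics*, Comm. Math. Phys. 5 (1967) 215–236.
* O. Bratteli, D. W. Robinson, *Operator Algebras and Quantum Statistical Mechanics I* (2nd ed.,
  Springer 1987), Def. 2.5.20 (analytic elements), Def. 2.7.1.
* O. Bratteli, D. W. Robinson, *Operator Algebras and Quantum Statistical Mechanics II* (2nd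
  ed., Springer 1997), Def. 5.3.1, Prop. 5.3.3, Prop. 5.3.7, Def. 5.3.18, Prop. 5.3.19,
  Thm. 5.3.30.
* X. Chen, Z.-C. Gu, X.-G. Wen, *Local unitary transformation, long-range quantum entanglement,
  wave function renormalization, and topological order*, Phys. Rev. B 82 (2010) 155138, §II.
* S. Bachmann, S. Michalakis, B. Nachtergaele, R. Sims, *Automorphic equivalence within gapped
  phases of quantum lattice systems*, Comm. Math. Phys. 309 (2012) 835–871, §1.
* H. Tasaki, *Physics and Mathematics of Quantum Many-Body Systems* (Springer 2020), Def. A.16.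
* J. Dereziński, C. Gérard, *Mathematics of Quantization and Quantum Fields* (CUP, 2013/2022),
  Def. 6.63 (KMS states, strip form), Prop. 6.64 (2) (KMS states are `τ`-invariant).
* J. B. Conway, *Functions of One Complex Variable* (Springer 1973), Ch. IX Thm. 1.1 (Schwarz
  reflection; its proof is the Morera-across-a-line argument used in the discharge).

## Mathlib search and design notes

* Mathlib (pinned) has no KMS states: `rg -il "KMS|Kubo"` only finds a TODO line in
  `Mathlib/Analysis/InnerProductSpace/StandardSubspace.lean` (Tomita–Takesaki). Used from
  Mathlib: `CStarAlgebra`, `StarAlgEquiv` (`≃⋆ₐ[ℂ]`), `Differentiable`/`DifferentiableOn ℂ`,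
  `ContinuousOn`, `Complex.I`, `Convex`, `WeakDual` (through the accepted `State.toWeakDual`).
* Reused from H21 (NOT redefined): `IsAutomorphismGroup τ` (orientation
  `τ (s + t) = (τ t).trans (τ s)`), `State.IsGroundState ω τ` (generator form) and
  `State.IsGroundState.apply_dynamics` (item Q15); `LatticeInteraction`, `HasFiniteRange`,
  `IsBounded`, `IsHermitian` (item Q3'), `groundStates`, `HasUniqueGroundState`,
  `HasUniqueGappedGroundState`, `InfVolState.IsGappedGroundState` (item Q13).
* The KMS condition is stated in the "`F_{a,b}` on the strip" form (BR II Prop. 5.3.7), which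
  needs no analytic elements; its equivalence with the entire-element form of BR II Def. 5.3.1,
  for states of the C⋆-algebra (`[StarOrderedRing A]`), is the named fact
  `State.isKMSState_iff_entire'`. `State.IsKMSState ω τ β` is intended for `0 < β`: for `β < 0`
  the strip `kmsStrip β = im ⁻¹' [0, β]` is empty and the predicate is vacuously true
  (`State.IsKMSState.of_neg`, `kmsStates_eq_univ`; use `τ ∘ Neg.neg` and `-β` instead);
  theorems carry `0 < β`, and `isClosed_kmsStates` also carries `IsAutomorphismGroup τ`
  (strong continuity is used in BR II Thm. 5.3.30).
* `InSameGappedPhase`: the regularity class of the path `s ↦ Φ s` is not uniform in the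
  literature (continuous / `C¹` / smooth); we choose continuity of every term on `[0, 1]`
  (flagged in the outline). The gap `γ` and the bound `J` are uniform along the path.
-/

noncomputable section

open Complex Topology

namespace Literature.Analysis.FunctionSpaces

section CStar

variable {A : Type*} [CStarAlgebra A]

/-! ### Analytic elements and the KMS strip -/

/-- `F : ℂ → A` is an **entire analytic extension** of the orbit `t ↦ τ_t(a)`: `F` is entire
(complex-differentiable on `ℂ`) and `F(t) = τ_t(a)` for real `t`. An element `a` admitting
such an `F` is an *entire analytic element* for `τ`; `F` is then unique and one writes
`τ_z(a) := F(z)`. Bratteli–Robinson I Def. 2.5.20; the entire elements form a norm-dense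
`τ`-invariant ⋆-subalgebra (Bratteli–Robinson I Prop. 2.5.22). [folklore] -/
def IsEntireElementFor (τ : ℝ → (A ≃⋆ₐ[ℂ] A)) (a : A) (F : ℂ → A) : Prop :=
  Differentiable ℂ F ∧ ∀ t : ℝ, F t = τ t a

/-- The closed **KMS strip** `{z ∈ ℂ | 0 ≤ Im z ≤ β} = im ⁻¹' [0, β]` (Mathlib's
Phragmén–Lindelöf idiom `im ⁻¹' _`, cf. `PhragmenLindelof.horizontal_strip`). Empty for `β < 0`.
Bratteli–Robinson II Prop. 5.3.7. [folklore] -/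
def kmsStrip (β : ℝ) : Set ℂ :=
  Complex.im ⁻¹' Set.Icc 0 β

/-- Membership in the KMS strip (definitional). Bratteli–Robinson II Prop. 5.3.7. [folklore] -/
@[simp]
theorem mem_kmsStrip {β : ℝ} {z : ℂ} : z ∈ kmsStrip β ↔ 0 ≤ z.im ∧ z.im ≤ β :=
  Iff.rfl

/-- The KMS strip is empty for negative `β`. Bratteli–Robinson II Prop. 5.3.7. [folklore] -/
theorem kmsStrip_eq_empty {β : ℝ} (hβ : β < 0) : kmsStrip β = ∅ := by
  ext z
  simp only [mem_kmsStrip, Set.mem_empty_iff_false, iff_false, not_and, not_le]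
  intro h
  linarith

/-- Real points lie in the KMS strip for `0 ≤ β`. Bratteli–Robinson II Prop. 5.3.7. [folklore] -/
theorem ofReal_mem_kmsStrip {β : ℝ} (hβ : 0 ≤ β) (t : ℝ) : (t : ℂ) ∈ kmsStrip β := by
  simp [hβ]

/-- The points `t + iβ` of the upper boundary lie in the KMS strip for `0 ≤ β`.
Bratteli–Robinson II Prop. 5.3.7. [folklore] -/
theorem ofReal_add_mul_I_mem_kmsStrip {β : ℝ} (hβ : 0 ≤ β) (t : ℝ) :
    (t : ℂ) + β * I ∈ kmsStrip β := by
  simp [hβ]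

/-! ### KMS states and analytic ground states -/

section States

variable [PartialOrder A]

/-- `ω` is a **`(τ, β)`-KMS state** (strip form): for all `a b ∈ A` there is a function
`F = F_{a,b} : ℂ → ℂ`, continuous and bounded on the closed strip `0 ≤ Im z ≤ β` and analytic
on the open strip `0 < Im z < β`, with boundary values `F(t) = ω(a τ_t(b))` and
`F(t + iβ) = ω(τ_t(b) a)` for all real `t`. Intended for `0 < β` (inverse temperature):
for `β < 0` the strip `kmsStrip β` is empty and the predicate is VACUOUSLY TRUE (junk value;
use `τ ∘ Neg.neg` and `-β` instead), and for `β = 0` it essentially says that `ω` is tracial.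
Haag–Hugenholtz–Winnink (1967); Bratteli–Robinson II Def. 5.3.1 and Prop. 5.3.7 (equivalence
of the strip form with the entire-element form, see `State.isKMSState_iff_entire'`).
(Dot-namespaced on `Literature.MathematicalPhysics.QuantumLattice.State`.) [cite: HaagHugenholtzWinnink1967] -/
def _root_.Literature.MathematicalPhysics.QuantumLattice.State.IsKMSState (ω : Literature.MathematicalPhysics.QuantumLattice.State A) (τ : ℝ → (A ≃⋆ₐ[ℂ] A)) (β : ℝ) : Prop :=
  ∀ a b : A, ∃ F : ℂ → ℂ, ContinuousOn F (kmsStrip β) ∧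
    DifferentiableOn ℂ F {z | 0 < z.im ∧ z.im < β} ∧ (∃ C, ∀ z ∈ kmsStrip β, ‖F z‖ ≤ C) ∧
    (∀ t : ℝ, F t = ω (a * τ t b)) ∧ ∀ t : ℝ, F (t + β * I) = ω (τ t b * a)

/-- `ω` is a **ground state in the analytic (`β = +∞` KMS) form**: for all `a b ∈ A` there is
a function `F = F_{a,b} : ℂ → ℂ`, continuous and bounded on the closed upper half-plane
`0 ≤ Im z` and analytic on the open upper half-plane, with `F(t) = ω(a τ_t(b))` for all real
`t`. Bratteli–Robinson II Def. 5.3.18 (second formulation) and Prop. 5.3.19 (2); for states of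
the C⋆-algebra (`[StarOrderedRing A]`) equivalent to the generator form `State.IsGroundState`
(theorem `State.isGroundState_iff_isKMSGroundState'`, named fact
`State.isGroundState_iff_isKMSGroundState_of_starOrderedRing`, both in
`Literature/Analysis/FunctionSpaces/KMSStatesGroundStateProofs.lean`).
(Dot-namespaced on `Literature.MathematicalPhysics.QuantumLattice.State`.) [folklore] -/
def _root_.Literature.MathematicalPhysics.QuantumLattice.State.IsKMSGroundState (ω : Literature.MathematicalPhysics.QuantumLattice.State A) (τ : ℝ → (A ≃⋆ₐ[ℂ] A)) : Prop :=
  ∀ a b : A, ∃ F : ℂ → ℂ, ContinuousOn F {z | 0 ≤ z.im} ∧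
    DifferentiableOn ℂ F {z | 0 < z.im} ∧ (∃ C, ∀ z ∈ {z : ℂ | 0 ≤ z.im}, ‖F z‖ ≤ C) ∧
    ∀ t : ℝ, F t = ω (a * τ t b)

/-- The set `K_β` of `(τ, β)`-KMS states. Intended for `0 < β`; for `β < 0` the predicate
`State.IsKMSState` is vacuous and `kmsStates τ β = Set.univ` (junk value, see
`kmsStates_eq_univ`). Bratteli–Robinson II Def. 5.3.1, Thm. 5.3.30. [folklore] -/
def kmsStates (τ : ℝ → (A ≃⋆ₐ[ℂ] A)) (β : ℝ) : Set (Literature.MathematicalPhysics.QuantumLattice.State A) :=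
  {ω | ω.IsKMSState τ β}

/-- The set `K_∞` of ground states in the analytic (`β = +∞` KMS) form. (Named
`kmsGroundStates` to avoid a clash with the accepted `QLattice.groundStates Φ R`.)
Bratteli–Robinson II Def. 5.3.18, Thm. 5.3.37. [folklore] -/
def kmsGroundStates (τ : ℝ → (A ≃⋆ₐ[ℂ] A)) : Set (Literature.MathematicalPhysics.QuantumLattice.State A) :=
  {ω | ω.IsKMSGroundState τ}

/-- Membership in `kmsStates` (definitional). Bratteli–Robinson II Def. 5.3.1. [folklore] -/
@[simp]
theorem mem_kmsStates {τ : ℝ → (A ≃⋆ₐ[ℂ] A)} {β : ℝ} {ω : Literature.MathematicalPhysics.QuantumLattice.State A} :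
    ω ∈ kmsStates τ β ↔ ω.IsKMSState τ β :=
  Iff.rfl

/-- Membership in `kmsGroundStates` (definitional). Bratteli–Robinson II Def. 5.3.18. [folklore] -/
@[simp]
theorem mem_kmsGroundStates {τ : ℝ → (A ≃⋆ₐ[ℂ] A)} {ω : Literature.MathematicalPhysics.QuantumLattice.State A} :
    ω ∈ kmsGroundStates τ ↔ ω.IsKMSGroundState τ :=
  Iff.rfl

/-- Junk value: for `β < 0` the KMS strip is empty, so every state is (vacuously) a
`(τ, β)`-KMS state in the sense of `State.IsKMSState`. Bratteli–Robinson II Def. 5.3.1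
(there negative `β` is handled by reflecting the strip; here use `τ ∘ Neg.neg` and `-β`).
[folklore] -/
theorem _root_.Literature.MathematicalPhysics.QuantumLattice.State.IsKMSState.of_neg {τ : ℝ → (A ≃⋆ₐ[ℂ] A)} {β : ℝ} (hβ : β < 0) (ω : Literature.MathematicalPhysics.QuantumLattice.State A) :
    ω.IsKMSState τ β := by
  intro a b
  refine ⟨fun z => if z.im = 0 then ω (a * τ z.re b) else ω (τ z.re b * a), ?_, ?_,
    ⟨0, fun z hz => ?_⟩, fun t => ?_, fun t => ?_⟩
  · rw [kmsStrip_eq_empty hβ]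
    exact continuousOn_empty _
  · intro z hz
    exfalso
    simp only [Set.mem_setOf_eq] at hz
    linarith [hz.1, hz.2]
  · rw [kmsStrip_eq_empty hβ] at hz
    exact hz.elim
  · simp
  · simp [hβ.ne]

/-- Junk value: `kmsStates τ β = Set.univ` for `β < 0` (`State.IsKMSState.of_neg`).
Bratteli–Robinson II Def. 5.3.1. [folklore] -/
theorem kmsStates_eq_univ {τ : ℝ → (A ≃⋆ₐ[ℂ] A)} {β : ℝ} (hβ : β < 0) :
    kmsStates (A := A) τ β = Set.univ :=
  Set.eq_univ_of_forall fun ω => Literature.MathematicalPhysics.QuantumLattice.State.IsKMSState.of_neg hβ ω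

variable {τ : ℝ → (A ≃⋆ₐ[ℂ] A)} {β : ℝ}

/-- **KMS states are invariant under the dynamics**: `ω ∘ τ_t = ω` for a `(τ, β)`-KMS state,
`β > 0` (Liouville applied to `F_{1,a}`, which is bounded, entire after reflection, and
`iβ`-periodic). Bratteli–Robinson II Prop. 5.3.3. (Name parallels the accepted
`State.IsGroundState.apply_dynamics`.) [cite: BratteliRobinsonII1997, Prop. 5.3.3] -/
def _root_.Literature.MathematicalPhysics.QuantumLattice.State.IsKMSState.apply_dynamics : Prop :=
  ∀ (hτ : Literature.MathematicalPhysics.QuantumLattice.IsAutomorphismGroup τ) (hβ : 0 < β) {ω : Literature.MathematicalPhysics.QuantumLattice.State A} (h : ω.IsKMSState τ β) (t : ℝ) (a : A),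
    ω (τ t a) = ω a

/-- **Deprecated (verdict clean-up 2026-08-15) — MIS-STATED; the statement is kept verbatim
only because its kernel-checked refutation names it.** Superseded by the named fact
`Literature.MathematicalPhysics.QuantumLattice.State.isGroundState_iff_isKMSGroundState_of_starOrderedRing`
of `Literature/Analysis/FunctionSpaces/KMSStatesGroundStateProofs.lean` (declared downstream of
this file, whence the text form of the `deprecated` attribute): the same body with the one
missing hypothesis, the instance binder `[StarOrderedRing A]` (the order of `A` is its
C⋆-order, so that `State A` is the set of states of the C⋆-algebra), discharged there as
`State.isGroundState_iff_isKMSGroundState_of_starOrderedRing_holds` through the sorry-free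
theorem `State.isGroundState_iff_isKMSGroundState'` (Bratteli–Robinson II Prop. 5.3.19 in its
printed generality).

*Intended content.* **Generator form ⇔ analytic form of the ground-state condition**: for a
strongly continuous one-parameter group `τ` of ⋆-automorphisms of a unital C⋆-algebra `A` with
generator `δ` and a state `ω`, `-i ω(a⋆ δ(a)) ≥ 0` on `D(δ)` iff for all `a b` the function
`t ↦ ω(a τ_t(b))` extends to a bounded continuous function on `Im z ≥ 0`, analytic in
`Im z > 0`. Bratteli–Robinson II Def. 5.3.18, Prop. 5.3.19 ((1) ⇔ (2)); Sakai, *Operator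
algebras in dynamical systems* (1991), Def. 4.2.1 (p. 107: "a state `φ` on `A` is said to be a
ground state for `{A, α}` if `-iφ(a⋆δ(a)) ≥ 0` for `a ∈ 𝒟(δ)`") with the `β = +∞` case of
Prop. 4.3.5 (§4.3: bounded holomorphic `F_{a,b}` on the upper half-plane, continuous on
`Im z ≥ 0`, with `F_{a,b}(t) = φ(a α_t(b))`).

*What is wrong.* In both sources a *state* is a positive linear functional of norm one
(Bratteli–Robinson I §2.3.2, Def. 2.3.9: "a positive linear functional `ω` over a C⋆-algebra `𝔄`
with `‖ω‖ = 1` is called a state"; Sakai (1991) §1.5, p. 2), and positivity is what the printed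
proof uses (`t ↦ ω(a⋆ τ_t(a))` is positive-definite, `H_ω ≥ 0` in the GNS covariant
representation). This declaration, however, sits in a section carrying only `[PartialOrder A]`,
so its parameters are the section implicits `{A} [CStarAlgebra A] [PartialOrder A] {τ}` with an
*arbitrary* partial order on `A`, unrelated to the ⋆-algebra structure, for which `State A`
(monotone linear `ω` with `ω 1 = 1`) need not consist of positive functionals. In that generality
the equivalence is false: on `A = B(ℂ²)` with the discrete order, `P = E₀₀`,
`τ_t = Ad (e^{it}P + (1 - P))` and the non-positive normalised functional `ω(x) = x₁₁ + x₀₁`,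
every `t ↦ ω(a τ_t(b))` equals `c₀ + c₁ e^{it}` (the analytic form holds) while
`-i ω(a⋆ δ(a)) = 1 - i` for `a = E₀₁ + iE₀₀` (the generator form fails). **Refutation (kept):**
`Literature.Analysis.FunctionSpaces.KMSGroundStateCounterexample.not_isGroundState_iff_isKMSGroundState`
(`Literature/Analysis/FunctionSpaces/KMSStatesCounterexample.lean`), which is why no
`State.isGroundState_iff_isKMSGroundState_holds` can exist and why the corrected statement is
not re-declared here (it would duplicate `…_of_starOrderedRing`). Do not consume
`(h : State.isGroundState_iff_isKMSGroundState)`; in a context carrying `[StarOrderedRing A]` use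
`State.isGroundState_iff_isKMSGroundState_of_starOrderedRing_holds` or the theorem
`State.isGroundState_iff_isKMSGroundState'` directly.
[cite: BratteliRobinsonII1997, Def. 5.3.18 and Prop. 5.3.19] -/
@[deprecated "mis-stated (arbitrary PartialOrder on A: State A need not consist of positive functionals; refuted as stated by Literature.Analysis.FunctionSpaces.KMSGroundStateCounterexample.not_isGroundState_iff_isKMSGroundState): use Literature.MathematicalPhysics.QuantumLattice.State.isGroundState_iff_isKMSGroundState_of_starOrderedRing (proved: …_of_starOrderedRing_holds, State.isGroundState_iff_isKMSGroundState') of KMSStatesGroundStateProofs.lean" (since := "2026-08-15")]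
def _root_.Literature.MathematicalPhysics.QuantumLattice.State.isGroundState_iff_isKMSGroundState : Prop :=
  ∀ (hτ : Literature.MathematicalPhysics.QuantumLattice.IsAutomorphismGroup τ) (ω : Literature.MathematicalPhysics.QuantumLattice.State A),
    ω.IsGroundState τ ↔ ω.IsKMSGroundState τ

/-- **The KMS condition on entire elements** (Bratteli–Robinson II Def. 5.3.1 ⇔ Prop. 5.3.7):
for a strongly continuous automorphism group `τ` and `β > 0`, `ω` is a `(τ, β)`-KMS state iff
`ω(a τ_{iβ}(b)) = ω(b a)` for every `a` and every entire analytic element `b`, where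
`τ_{iβ}(b) = F(iβ)` for the (unique) entire extension `F` of `t ↦ τ_t(b)`.

**Caveat — mis-stated as a bare closure; scope of validity.** This def sits in a section
carrying only `[PartialOrder A]`, i.e. it is a `Prop` family indexed (through the section
implicits `{A} [CStarAlgebra A] [PartialOrder A] {τ} {β}`) by an *arbitrary* partial order on `A`,
for which `ω : State A` need not be continuous, whereas the source's states are states of the
C⋆-algebra (positive for the C⋆-order, hence continuous, BR I Prop. 2.3.11) and the printed proof
uses this continuity in both directions. The universal closure of this def over all partial
orders is false: for `A = M₂(C([0,1], ℂ))` with the discrete order and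
`τ_t = Ad diag(1, e^{itx})`, a discontinuous (Hamel-basis) linear functional `ω` with `ω 1 = 1`
can satisfy the entire-element relation without satisfying the (bounded) strip form
(`Literature.MathematicalPhysics.QuantumLattice.State.not_isKMSState_iff_entire` in
`Literature/Analysis/FunctionSpaces/KMSStatesEntireCounterexample.lean`). The statement is kept
unchanged. At every C⋆-ordered `A` (instance `[StarOrderedRing A]`: the order of `A` is the
C⋆-order, the source's setting) the family holds and is discharged as
`Literature.MathematicalPhysics.QuantumLattice.State.isKMSState_iff_entire_holds`
(`Literature/Analysis/FunctionSpaces/KMSStatesProofs.lean`), so a hypothesis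
`(h : State.isKMSState_iff_entire)` in a context carrying `[StarOrderedRing A]` is fed that
theorem; without the instance no discharge exists. New statements should rather use the closed
corrected fact `State.isKMSState_iff_entire'` below (same body, `[StarOrderedRing A]` as an
explicit instance binder), proved as `State.isKMSState_iff_entire'_holds` in the same file; under
`[StarOrderedRing A]` the two coincide
(`State.isKMSState_iff_entire_iff_isKMSState_iff_entire'`).
[cite: BratteliRobinsonII1997, Prop. 5.3.7] -/
def _root_.Literature.MathematicalPhysics.QuantumLattice.State.isKMSState_iff_entire : Prop :=
  ∀ (hτ : Literature.MathematicalPhysics.QuantumLattice.IsAutomorphismGroup τ) (hβ : 0 < β) (ω : Literature.MathematicalPhysics.QuantumLattice.State A),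
    ω.IsKMSState τ β ↔
      ∀ (a b : A) (F : ℂ → A), IsEntireElementFor τ b F → ω (a * F (β * I)) = ω (b * a)

/-- **The KMS condition on entire elements** (Bratteli–Robinson II Def. 5.3.1 ⇔ Prop. 5.3.7),
corrected statement of `State.isKMSState_iff_entire`: for a strongly continuous automorphism
group `τ` of the C⋆-algebra `A` (with its C⋆-order, `[StarOrderedRing A]`) and `β > 0`, a state
`ω` is a `(τ, β)`-KMS state (strip form, `State.IsKMSState`) iff `ω(a τ_{iβ}(b)) = ω(b a)` for
every `a` and every entire analytic element `b`, where `τ_{iβ}(b) = F(iβ)` for the (unique)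
entire extension `F` of `t ↦ τ_t(b)`.

Discrepancy with `State.isKMSState_iff_entire`: that def is stated in this section, which
carries only `[PartialOrder A]`, i.e. for an *arbitrary* partial order on `A`, so that
`ω : State A` (a positive normalised linear functional for that order) need not be continuous;
the source's states are states of the C⋆-algebra (positive for the C⋆-order, hence continuous,
Bratteli–Robinson I Prop. 2.3.11), and both directions of the printed proof (BR II Prop. 5.3.7;
Sakai, *Operator algebras in dynamical systems* (1991) Prop. 4.3.4) use the continuity of `ω`
(analyticity of `z ↦ ω(a F(z))`, norm approximation by entire elements); for the discrete order
on `M₂(C([0,1], ℂ))` the uncorrected statement fails. This corrected statement therefore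
carries the additional instance hypothesis `[StarOrderedRing A]` (the order of `A` is the
C⋆-order) as an explicit binder of the def, so that
`@State.isKMSState_iff_entire' : ∀ {A} [CStarAlgebra A] [PartialOrder A] {τ} {β},
[StarOrderedRing A] → Prop`; it is proved as `State.isKMSState_iff_entire'_holds` in
`Literature/Analysis/FunctionSpaces/KMSStatesProofs.lean`.
[cite: BratteliRobinsonII1997, Prop. 5.3.7] -/
def _root_.Literature.MathematicalPhysics.QuantumLattice.State.isKMSState_iff_entire' [StarOrderedRing A] : Prop :=
  ∀ (hτ : Literature.MathematicalPhysics.QuantumLattice.IsAutomorphismGroup τ) (hβ : 0 < β) (ω : Literature.MathematicalPhysics.QuantumLattice.State A),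
    ω.IsKMSState τ β ↔
      ∀ (a b : A) (F : ℂ → A), IsEntireElementFor τ b F → ω (a * F (β * I)) = ω (b * a)

/-- The analytic ground states are exactly the ground states in the generator form (from the
bridge, Bratteli–Robinson II Prop. 5.3.19). **Caveat (a `Prop` family over an arbitrary partial
order on `A`, like the deprecated `State.isGroundState_iff_isKMSGroundState`; its bare universal
closure is false, `KMSGroundStateCounterexample.not_kmsGroundStates_eq` in
`KMSStatesGroundStatesEqCounterexample.lean`).** At every C⋆-ordered `A` (`[StarOrderedRing A]`)
the family holds: `kmsGroundStates_eq_holds` (`KMSStatesGroundStatesEqProofs.lean`), from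
`Literature.MathematicalPhysics.QuantumLattice.State.kmsGroundStates_eq_setOf_isGroundState` /
`State.isGroundState_iff_isKMSGroundState'`
(`Literature/Analysis/FunctionSpaces/KMSStatesGroundStateProofs.lean`). [folklore] -/
def kmsGroundStates_eq : Prop :=
  ∀ (hτ : Literature.MathematicalPhysics.QuantumLattice.IsAutomorphismGroup τ),
    kmsGroundStates τ = {ω : Literature.MathematicalPhysics.QuantumLattice.State A | ω.IsGroundState τ}

/- interim proof relied on results that are now named facts (D-0014); demoted to a fact by the M5
import. The preserved proof term, with the corrected (C⋆-ordered) bridge, is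
`Set.ext fun ω => (State.isGroundState_iff_isKMSGroundState' hτ ω).symm`
(= `State.kmsGroundStates_eq_setOf_isGroundState hτ`, `KMSStatesGroundStateProofs.lean`); the
discharge under `[StarOrderedRing A]` is `kmsGroundStates_eq_holds`
(`KMSStatesGroundStatesEqProofs.lean`). -/

variable [StarOrderedRing A]

/-- **The KMS states form a convex set** (in the weak-⋆ dual): `F_{a,b}` depends linearly on
`ω`. Bratteli–Robinson II Thm. 5.3.30 (1). [cite: BratteliRobinsonII1997, Thm. 5.3.30 (1)] -/
def convex_kmsStates : Prop :=
  ∀ (hβ : 0 < β),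
    Convex ℝ (Literature.MathematicalPhysics.QuantumLattice.State.toWeakDual '' kmsStates (A := A) τ β)

/-- **The KMS states of a C⋆-dynamical system form a weak-⋆ closed set** (hence a weak-⋆
compact convex subset of the state space): for a strongly continuous automorphism group `τ`
(`hτ`, needed for the equicontinuity of `t ↦ ω_α(a τ_t(b))` along a convergent net `ω_α`, via
`‖τ_t(b) - τ_s(b)‖ → 0`) and `β > 0`, the three-line bound `|F_{a,b}(z)| ≤ ‖a‖ ‖b‖` lets the
functions `F_{a,b}` pass to weak-⋆ limits. Bratteli–Robinson II Thm. 5.3.30 (1); Prop. 5.3.7.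
[cite: BratteliRobinsonII1997, Thm. 5.3.30 (1)] -/
def isClosed_kmsStates : Prop :=
  ∀ (hτ : Literature.MathematicalPhysics.QuantumLattice.IsAutomorphismGroup τ) (hβ : 0 < β),
    IsClosed (Literature.MathematicalPhysics.QuantumLattice.State.toWeakDual '' kmsStates (A := A) τ β)

end States

end CStar

/-! ### Appendix: gapped phases of lattice interactions -/

section QLattice

variable {d q : ℕ}

/-- Two lattice interactions `Φ₀ Φ₁` of finite range `R` are **in the same gapped phase**:
they are connected by a path `s ↦ Φ s`, `s ∈ [0, 1]`, of Hermitian interactions of range `R`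
with uniformly bounded terms (`‖Φ s X‖ ≤ J`), each term depending continuously on `s`, such
that every `Φ s` has a unique infinite-volume ground state, gapped with a gap `γ > 0` uniform
in `s`. Chen–Gu–Wen, Phys. Rev. B 82 (2010) §II; Bachmann–Michalakis–Nachtergaele–Sims,
Comm. Math. Phys. 309 (2012) §1; gap notion of Tasaki (2020) Def. A.16
(`InfVolState.IsGappedGroundState`). The regularity of the path (here: continuity of every
term on `[0, 1]`) varies in the literature. (In the last clause the membership
`ω ∈ groundStates (Φ s) R` is redundant, being implied by `IsGappedGroundState.isGroundState`;
it is kept for readability.) [cite: Tasaki2020] -/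
def InSameGappedPhase (Φ₀ Φ₁ : Literature.MathematicalPhysics.QuantumLattice.LatticeInteraction d q) (R : ℝ) : Prop :=
  ∃ (γ J : ℝ) (Φ : ℝ → Literature.MathematicalPhysics.QuantumLattice.LatticeInteraction d q), 0 < γ ∧ Φ 0 = Φ₀ ∧ Φ 1 = Φ₁ ∧
    (∀ X, ContinuousOn (fun s => Φ s X) (Set.Icc 0 1)) ∧
    ∀ s ∈ Set.Icc (0 : ℝ) 1, (Φ s).IsHermitian ∧ (Φ s).HasFiniteRange R ∧ (Φ s).IsBounded J ∧
      Literature.MathematicalPhysics.QuantumLattice.HasUniqueGroundState (Φ s) R ∧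
      ∃ ω ∈ Literature.MathematicalPhysics.QuantumLattice.groundStates (Φ s) R, ω.IsGappedGroundState (Φ s) R γ

/-- A Hermitian finite-range interaction with bounded terms and a unique gapped ground state is
in the same gapped phase as itself (constant path). Bachmann–Michalakis–Nachtergaele–Sims
(2012) §1. [folklore] -/
theorem InSameGappedPhase.refl {Φ : Literature.MathematicalPhysics.QuantumLattice.LatticeInteraction d q} {R J : ℝ} (hH : Φ.IsHermitian)
    (hR : Φ.HasFiniteRange R) (hb : Φ.IsBounded J) (h : Literature.MathematicalPhysics.QuantumLattice.HasUniqueGappedGroundState Φ R) :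
    InSameGappedPhase Φ Φ R := by
  obtain ⟨hu, ω, γ, hω⟩ := h
  exact ⟨γ, J, fun _ => Φ, hω.pos, rfl, rfl, fun _ => continuousOn_const, fun _ _ =>
    ⟨hH, hR, hb, hu, ω, hω.isGroundState, hω⟩⟩

/-- Being in the same gapped phase is symmetric (reverse the path, `s ↦ Φ (1 - s)`).
Bachmann–Michalakis–Nachtergaele–Sims (2012) §1. [cite: BachmannMichalakisNachtergaeleSims2012] -/
theorem InSameGappedPhase.symm {Φ₀ Φ₁ : Literature.MathematicalPhysics.QuantumLattice.LatticeInteraction d q} {R : ℝ}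
    (h : InSameGappedPhase Φ₀ Φ₁ R) : InSameGappedPhase Φ₁ Φ₀ R := by
  obtain ⟨γ, J, Φ, hγ, h0, h1, hc, hs⟩ := h
  have hmaps : Set.MapsTo (fun s : ℝ => 1 - s) (Set.Icc 0 1) (Set.Icc 0 1) := by
    intro s hs
    simp only [Set.mem_Icc] at hs ⊢
    constructor <;> linarith
  refine ⟨γ, J, fun s => Φ (1 - s), hγ, by simpa using h1, by simpa using h0, fun X => ?_,
    fun s hs' => hs (1 - s) (hmaps hs')⟩
  exact (hc X).comp (continuousOn_const.sub continuousOn_id) hmaps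

end QLattice

/-! ### Discharge: KMS states are invariant under the dynamics (BR II Prop. 5.3.3)

Sorry-free proof of the named fact `State.IsKMSState.apply_dynamics`, run directly on the strip
form of the KMS condition (no analytic elements, no continuity of `ω` needed). -/

section KMSInvariance

open Set
open scoped Interval

section Morera

variable {E : Type*} [NormedAddCommGroup E] [NormedSpace ℂ E] [CompleteSpace E]

/-- **Morera across a horizontal line**: a function continuous on an open set `U ⊆ ℂ` and
complex-differentiable on `U` off the horizontal line `Im z = c` is complex-differentiable on `U`
(rectangle integrals vanish: split a rectangle at height `c` and apply Cauchy–Goursat, Mathlib's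
`integral_boundary_rect_eq_zero_of_continuousOn_of_differentiableOn`, to each half; conclude by
Morera's theorem `Complex.isConservativeOn_and_continuousOn_iff_isDifferentiableOn`).
Standard: this is the argument in the proof of the Schwarz reflection principle, Conway,
*Functions of One Complex Variable* (1973), Ch. IX Thm. 1.1. [folklore] -/
theorem differentiableOn_of_continuousOn_of_differentiableOn_off_im_eq {f : ℂ → E} {U : Set ℂ}
    (hU : IsOpen U) (c : ℝ) (hc : ContinuousOn f U)
    (hd : DifferentiableOn ℂ f (U \ {z | z.im = c})) : DifferentiableOn ℂ f U := by
  refine ((Complex.isConservativeOn_and_continuousOn_iff_isDifferentiableOn hU).1 ⟨?_, hc⟩)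
  -- rectangles whose interior misses the line
  have key : ∀ z w : ℂ, Rectangle z w ⊆ U → c ∉ Ioo (min z.im w.im) (max z.im w.im) →
      wedgeIntegral z w f + wedgeIntegral w z f = 0 := by
    intro z w hzw hcz
    rw [wedgeIntegral_add_wedgeIntegral_eq]
    refine integral_boundary_rect_eq_zero_of_continuousOn_of_differentiableOn f z w (hc.mono hzw)
      (hd.mono fun p hp => ⟨hzw ⟨Ioo_subset_Icc_self hp.1, Ioo_subset_Icc_self hp.2⟩, fun hpc => ?_⟩)
    rw [mem_setOf_eq] at hpc
    exact hcz (hpc ▸ hp.2)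
  intro z w hzw
  rw [eq_neg_iff_add_eq_zero]
  by_cases hcz : c ∈ Ioo (min z.im w.im) (max z.im w.im)
  swap
  · exact key z w hzw hcz
  have hcI : c ∈ [[z.im, w.im]] := Ioo_subset_Icc_self hcz
  have hsub1 : [[z.im, c]] ⊆ [[z.im, w.im]] := uIcc_subset_uIcc_left hcI
  have hsub2 : [[c, w.im]] ⊆ [[z.im, w.im]] := uIcc_subset_uIcc_right hcI
  have hre1 : ((w.re : ℂ) + c * I).re = w.re := by simp
  have him1 : ((w.re : ℂ) + c * I).im = c := by simp
  have hre2 : ((z.re : ℂ) + c * I).re = z.re := by simp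
  have him2 : ((z.re : ℂ) + c * I).im = c := by simp
  have hR1 : Rectangle z (w.re + c * I) ⊆ U := by
    refine Subset.trans (fun p hp => ?_) hzw
    rw [Rectangle, mem_reProdIm] at hp ⊢
    rw [hre1, him1] at hp
    exact ⟨hp.1, hsub1 hp.2⟩
  have hR2 : Rectangle (z.re + c * I) w ⊆ U := by
    refine Subset.trans (fun p hp => ?_) hzw
    rw [Rectangle, mem_reProdIm] at hp ⊢
    rw [hre2, him2] at hp
    exact ⟨hp.1, hsub2 hp.2⟩
  have hc1 : c ∉ Ioo (min z.im ((w.re : ℂ) + c * I).im) (max z.im ((w.re : ℂ) + c * I).im) := by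
    rw [him1]
    rintro ⟨h1, h2⟩
    rw [min_lt_iff] at h1
    rw [lt_max_iff] at h2
    rcases h1 with h1 | h1 <;> rcases h2 with h2 | h2 <;> linarith
  have hc2 : c ∉ Ioo (min ((z.re : ℂ) + c * I).im w.im) (max ((z.re : ℂ) + c * I).im w.im) := by
    rw [him2]
    rintro ⟨h1, h2⟩
    rw [min_lt_iff] at h1
    rw [lt_max_iff] at h2
    rcases h1 with h1 | h1 <;> rcases h2 with h2 | h2 <;> linarith
  have h1 := key z _ hR1 hc1
  have h2 := key _ w hR2 hc2
  rw [wedgeIntegral_add_wedgeIntegral_eq, hre1, him1] at h1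
  rw [wedgeIntegral_add_wedgeIntegral_eq, hre2, him2] at h2
  rw [wedgeIntegral_add_wedgeIntegral_eq]
  -- vertical segments lie in `U`
  have hvert : ∀ x ∈ [[z.re, w.re]], ∀ a b : ℝ, [[a, b]] ⊆ [[z.im, w.im]] →
      IntervalIntegrable (fun y : ℝ => f (x + y * I)) MeasureTheory.volume a b := by
    intro x hx a b hab
    refine (hc.comp (Continuous.continuousOn (by fun_prop)) fun y hy => hzw ?_).intervalIntegrable
    rw [Rectangle, mem_reProdIm]
    constructor
    · simpa using hx
    · simpa using hab hy
  have hv1 : (∫ y : ℝ in z.im..w.im, f (w.re + y * I)) =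
      (∫ y : ℝ in z.im..c, f (w.re + y * I)) + ∫ y : ℝ in c..w.im, f (w.re + y * I) :=
    (intervalIntegral.integral_add_adjacent_intervals (hvert _ right_mem_uIcc _ _ hsub1)
      (hvert _ right_mem_uIcc _ _ hsub2)).symm
  have hv2 : (∫ y : ℝ in z.im..w.im, f (z.re + y * I)) =
      (∫ y : ℝ in z.im..c, f (z.re + y * I)) + ∫ y : ℝ in c..w.im, f (z.re + y * I) :=
    (intervalIntegral.integral_add_adjacent_intervals (hvert _ left_mem_uIcc _ _ hsub1)
      (hvert _ left_mem_uIcc _ _ hsub2)).symm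
  convert congrArg₂ (· + ·) h1 h2 using 1
  · rw [hv1, hv2, smul_add, smul_add]
    abel
  · simp

end Morera

section KMS

/-- Gluing across the real axis: if `F` is continuous on the closed KMS strip `0 ≤ Im z ≤ β`,
analytic in the open strip and satisfies `F(s + iβ) = F(s)` for real `s`, then the function equal to
`F` on `Im z ≥ 0` and to `F(· + iβ)` on `Im z < 0` is analytic on the open strip `-β < Im z < β`.
Step in Bratteli–Robinson II Prop. 5.3.3. [folklore] -/
theorem differentiableOn_kmsGlue {F : ℂ → ℂ} {β : ℝ}
    (hFc : ContinuousOn F (kmsStrip β)) (hFd : DifferentiableOn ℂ F {z | 0 < z.im ∧ z.im < β})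
    (hper : ∀ s : ℝ, F (s + β * I) = F s) :
    DifferentiableOn ℂ (fun z : ℂ => if 0 ≤ z.im then F z else F (z + β * I))
      (Complex.im ⁻¹' Ioo (-β) β) := by
  have hUo : IsOpen (Complex.im ⁻¹' Ioo (-β) β) := isOpen_Ioo.preimage Complex.continuous_im
  have hSo : IsOpen {z : ℂ | 0 < z.im ∧ z.im < β} := isOpen_Ioo.preimage Complex.continuous_im
  refine differentiableOn_of_continuousOn_of_differentiableOn_off_im_eq hUo 0 ?_ ?_
  · refine ContinuousOn.if ?_ ?_ ?_
    · rintro a ⟨haU, ha⟩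
      rw [frontier_setOf_le_im] at ha
      have hare : a = (a.re : ℂ) := by
        apply Complex.ext
        · simp
        · simpa using ha
      rw [hare, hper]
    · refine hFc.mono ?_
      rintro a ⟨haU, ha⟩
      rw [(isClosed_le continuous_const Complex.continuous_im).closure_eq] at ha
      exact ⟨ha, haU.2.le⟩
    · have hcl : closure {a : ℂ | ¬0 ≤ a.im} = {a | a.im ≤ 0} := by
        simp_rw [not_le]
        exact closure_setOf_im_lt 0
      rw [hcl]
      refine hFc.comp (Continuous.continuousOn (by fun_prop)) ?_
      rintro a ⟨haU, ha⟩
      simp only [mem_preimage, mem_Ioo] at haU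
      simp only [mem_setOf_eq] at ha
      simp only [mem_kmsStrip, add_im, mul_im, ofReal_re, I_im, mul_one, ofReal_im, I_re, mul_zero,
        add_zero]
      constructor <;> linarith
  · rintro z ⟨hzU, hz0⟩
    simp only [mem_preimage, mem_Ioo] at hzU
    have hz0' : z.im ≠ 0 := hz0
    rcases lt_or_gt_of_ne hz0' with hneg | hpos
    · have hev : (fun z : ℂ => if 0 ≤ z.im then F z else F (z + β * I)) =ᶠ[𝓝 z]
          fun w => F (w + β * I) := by
        filter_upwards [(isOpen_lt Complex.continuous_im continuous_const).mem_nhds hneg] with w hw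
        rw [if_neg (not_le.mpr hw)]
      refine (hev.differentiableAt_iff.mpr ?_).differentiableWithinAt
      have hmem : z + β * I ∈ {z : ℂ | 0 < z.im ∧ z.im < β} := by
        simp only [mem_setOf_eq, add_im, mul_im, ofReal_re, I_im, mul_one, ofReal_im, I_re,
          mul_zero, add_zero]
        constructor <;> linarith
      have h1 : DifferentiableAt ℂ F (z + β * I) := hFd.differentiableAt (hSo.mem_nhds hmem)
      have h2 : DifferentiableAt ℂ (fun w : ℂ => w + β * I) z := by fun_prop
      exact h1.comp z h2
    · have hev : (fun z : ℂ => if 0 ≤ z.im then F z else F (z + β * I)) =ᶠ[𝓝 z] F := by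
        filter_upwards [(isOpen_lt continuous_const Complex.continuous_im).mem_nhds hpos] with w hw
        rw [if_pos (le_of_lt hw)]
      refine (hev.differentiableAt_iff.mpr ?_).differentiableWithinAt
      exact hFd.differentiableAt (hSo.mem_nhds ⟨hpos, hzU.2⟩)

/-- **Liouville step of Bratteli–Robinson II Prop. 5.3.3**: a function `F` bounded and
continuous on the closed KMS strip `0 ≤ Im z ≤ β` (`β > 0`), analytic in the open strip, with
`F(s + iβ) = F(s)` for all real `s`, is constant on the real axis (its `iβ`-periodic extension is a
bounded entire function). [folklore] -/
theorem apply_ofReal_eq_of_kmsPeriodic {F : ℂ → ℂ} {β : ℝ} (hβ : 0 < β)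
    (hFc : ContinuousOn F (kmsStrip β)) (hFd : DifferentiableOn ℂ F {z | 0 < z.im ∧ z.im < β})
    (hFb : ∃ C, ∀ z ∈ kmsStrip β, ‖F z‖ ≤ C) (hper : ∀ s : ℝ, F (s + β * I) = F s) (s : ℝ) :
    F s = F 0 := by
  obtain ⟨C, hC⟩ := hFb
  have hUo : IsOpen (Complex.im ⁻¹' Ioo (-β) β) := isOpen_Ioo.preimage Complex.continuous_im
  have hGd := differentiableOn_kmsGlue hFc hFd hper
  -- the periodic extension
  set H : ℂ → ℂ := fun z => F ((z.re : ℂ) + (toIcoMod hβ 0 z.im : ℝ) * I) with hH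
  have hHd : Differentiable ℂ H := by
    intro z
    obtain ⟨k, hk⟩ : ∃ k : ℤ, z.im - k * β ∈ Ico 0 β :=
      ⟨toIcoDiv hβ 0 z.im, by rw [← zsmul_eq_mul, self_sub_toIcoDiv_zsmul]; exact toIcoMod_mem_Ico' hβ _⟩
    have hev : H =ᶠ[𝓝 z] fun w =>
        (fun z : ℂ => if 0 ≤ z.im then F z else F (z + β * I)) (w - ((k * β : ℝ) : ℂ) * I) := by
      have hV : Complex.im ⁻¹' Ioo ((k : ℝ) * β - β) ((k : ℝ) * β + β) ∈ 𝓝 z :=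
        (isOpen_Ioo.preimage Complex.continuous_im).mem_nhds (by
          simp only [mem_preimage, mem_Ioo]
          constructor <;> linarith [hk.1, hk.2])
      filter_upwards [hV] with w hw
      simp only [mem_preimage, mem_Ioo] at hw
      have him : (w - ((k * β : ℝ) : ℂ) * I).im = w.im - k * β := by simp
      by_cases hwk : (k : ℝ) * β ≤ w.im
      · have hmod : toIcoMod hβ 0 w.im = w.im - k * β := by
          rw [toIcoMod_eq_iff hβ]
          refine ⟨⟨by linarith, by linarith⟩, k, ?_⟩
          rw [zsmul_eq_mul]
          ring
        have him' : 0 ≤ (w - ((k * β : ℝ) : ℂ) * I).im := by rw [him]; linarith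
        simp only [hH]
        rw [if_pos him', hmod]
        congr 1
        apply Complex.ext <;> simp
      · have hmod : toIcoMod hβ 0 w.im = w.im - k * β + β := by
          rw [toIcoMod_eq_iff hβ]
          refine ⟨⟨by linarith, by linarith⟩, k - 1, ?_⟩
          rw [zsmul_eq_mul]
          push_cast
          ring
        have him' : ¬0 ≤ (w - ((k * β : ℝ) : ℂ) * I).im := by rw [him]; linarith
        simp only [hH]
        rw [if_neg him', hmod]
        congr 1
        apply Complex.ext <;> simp
    refine hev.differentiableAt_iff.mpr ?_
    have hmemU : z - ((k * β : ℝ) : ℂ) * I ∈ Complex.im ⁻¹' Ioo (-β) β := by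
      simp only [mem_preimage, mem_Ioo, sub_im, mul_im, ofReal_re, I_im, mul_one, ofReal_im, I_re,
        mul_zero, add_zero]
      constructor <;> linarith [hk.1, hk.2]
    have h2 : DifferentiableAt ℂ (fun w : ℂ => w - ((k * β : ℝ) : ℂ) * I) z := by fun_prop
    exact (hGd.differentiableAt (hUo.mem_nhds hmemU)).comp z h2
  have hHb : Bornology.IsBounded (range H) := by
    rw [Metric.isBounded_iff_subset_closedBall 0]
    refine ⟨C, ?_⟩
    rintro _ ⟨z, rfl⟩
    rw [Metric.mem_closedBall, dist_zero_right]
    apply hC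
    have hm := toIcoMod_mem_Ico' hβ z.im
    simp only [mem_kmsStrip, add_im, ofReal_im, mul_im, ofReal_re, I_im, mul_one, I_re, mul_zero,
      add_zero, zero_add]
    exact ⟨hm.1, hm.2.le⟩
  have hHreal : ∀ r : ℝ, H r = F r := fun r => by
    simp only [hH, ofReal_re, ofReal_im, toIcoMod_apply_left, ofReal_zero, zero_mul, add_zero]
  have hconst := hHd.apply_eq_apply_of_bounded hHb (s : ℂ) ((0 : ℝ) : ℂ)
  rw [hHreal, hHreal, ofReal_zero] at hconst
  exact hconst

variable {A : Type*} [CStarAlgebra A] [PartialOrder A] {τ : ℝ → (A ≃⋆ₐ[ℂ] A)} {β : ℝ}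

/-- **KMS states are invariant under the dynamics** (discharge of the named fact
`State.IsKMSState.apply_dynamics`): for `β > 0` and a `(τ, β)`-KMS state `ω` (strip form),
`ω (τ_t a) = ω a`. Proof as in Bratteli–Robinson II Prop. 5.3.3, run directly on the strip form
(cf. Dereziński–Gérard, *Mathematics of Quantization and Quantum Fields*, Def. 6.63,
Prop. 6.64 (2)): the KMS function `F = F_{1,a}` has equal boundary values
`F(t) = F(t + iβ) = ω(τ_t a)`, so gluing `F` with `F(· + iβ)` across the real axis (Morera) and
extending `iβ`-periodically gives a bounded entire function, constant by Liouville; hence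
`ω(τ_t a) = F(t) = F(0) = ω(τ_0 a) = ω(a)`. Only `τ 0 = id` from `IsAutomorphismGroup τ` is used.
[cite: BratteliRobinsonII1997, Prop. 5.3.3] -/
theorem _root_.Literature.MathematicalPhysics.QuantumLattice.State.IsKMSState.apply_dynamics_holds :
    Literature.MathematicalPhysics.QuantumLattice.State.IsKMSState.apply_dynamics (A := A) (τ := τ) (β := β) := by
  intro hτ hβ ω h t a
  obtain ⟨F, hFc, hFd, hFb, hF0, hFβ⟩ := h 1 a
  simp only [one_mul, mul_one] at hF0 hFβ
  have hper : ∀ s : ℝ, F (s + β * I) = F s := fun s => by rw [hFβ, hF0]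
  have hconst := apply_ofReal_eq_of_kmsPeriodic hβ hFc hFd hFb hper t
  rw [hF0, ← ofReal_zero, hF0, hτ.1] at hconst
  simpa using hconst

end KMS

end KMSInvariance

end Literature.Analysis.FunctionSpaces
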